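import Summits.HodgeConjecture.HodgeCM.StubTree.Qw8Monomial_2

/-! PORT of `HodgeCM/StubTree/Qw8Monomial.lean` (HodgeCMPerL run 82) — part 3: continuation of `Summits.HodgeConjecture.HodgeCM.StubTree.Qw8Monomial_2` (split at a top-level declaration boundary by port_pkg.py; scope re-opened below; declarations unchanged). -/

-- port_pkg: scope re-opened for this part (file-level context, then the namespace/section stack open at the cut)
noncomputable section
open scoped TensorProduct NumberField Classical
namespace HodgeCM
open Literature.AlgebraicGeometry.Motives (CMType)
open HodgeCM.Pohlmann
namespace Universe
variable (U : Universe)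
variable {U}
/-- **`Qw8MilneZero` is a THEOREM of `ModelAxioms`, N1, N3, F7, `Fact_dimProd`, `Fact_trTopCM` and `Qw8MilnePos`**
(so, with `qw8MilnePos_of_facts`, of the model axioms + N1–N4 + F4, F5, F7 + the two generic facts).
Proof: for `0 ≠ x ∈ H⁰(Y) ⊗ ℂ` take any second block `Y' = A_{Θ 0}` and its TOP eigen-monomial `ω`
(`∫ ω ≠ 0`, weight `(univ)`); `Z := p_Y^* x ∪ p_{Y'}^* ω ≠ 0` (push–pull F7 (ii): `p_{Y*} Z = (∫ω) x`) is a weight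
vector of weight `((∅)_j, univ)`, i.e. of character `0`, in positive degree `2 dim Y'`, hence algebraic
(`Qw8MilnePos`); so `(∫ω) x = p_{Y*} Z` is algebraic (F7 (i)). -/
theorem qw8MilneZero_of_genericFacts (M : U.ModelAxioms) (hN1 : U.Fact_cupExterior) (hN3 : U.Fact_pull_H0)
    (h7 : U.Fact_gysin) (hd : U.Fact_dimProd) (ht : U.Fact_trTopCM) (hpos : U.Qw8MilnePos) : U.Qw8MilneZero := by
  intro F hG h6 z hzp
  obtain ⟨n, Θ, p, S, x, hx0, hxw⟩ := z
  change p = 0 at hzp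
  subst hzp
  change x ∈ U.algC (U.cmProd F Θ) 0
  let Θ' : Fin (0 + 1) → CMType F := fun _ => Θ 0
  let Ξ : Fin (n + 1 + (0 + 1)) → CMType F := Fin.append Θ Θ'
  have hA : blkA Ξ = Θ := blkA_append Θ Θ'
  obtain ⟨x₂, h0x, -, hax⟩ := U.transport_wvec hA.symm 0 S x
  have hx₂0 : x₂ ≠ 0 := fun h => hx0 (h0x.mpr h)
  obtain ⟨pA, pB, hP⟩ := U.blockPair_exists M.pull_id M.pull_comp M.lift F n 0 Ξ
  -- the top eigen-monomial `ω` of `Y'`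
  obtain ⟨β, -, hβ⟩ := exists_integral_injective_eval F
  choose xB hxB _hx0 hsp using fun i => exists_eigenbasis M F (blkB Ξ i) β hβ
  have h2d : 2 * U.dim (U.cmProd F (blkB Ξ)) = Module.finrank ℚ F := by
    have h := U.two_mul_dim_cmProd_of_dimProd M hd F (blkB Ξ)
    simpa using h
  have hdpos : 0 < U.dim (U.cmProd F (blkB Ξ)) := by omega
  obtain ⟨K, hK⟩ : ∃ K, 2 * U.dim (U.cmProd F (blkB Ξ)) = K + 1 := ⟨2 * U.dim (U.cmProd F (blkB Ξ)) - 1, by omega⟩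
  have hcard : Fintype.card (Fin (0 + 1) × ((F : Type) →+* ℂ)) = K + 1 := by
    rw [card_index]; simp only [zero_add, one_mul]; omega
  let q : Fin (K + 1) → Fin (0 + 1) × ((F : Type) →+* ℂ) := fun t => (Fintype.equivFin _).symm (finCongr hcard.symm t)
  have hqb : Function.Bijective q := (Fintype.equivFin _).symm.bijective.comp (finCongr hcard.symm).bijective
  let ω : U.CohC (U.cmProd F (blkB Ξ)) (2 * U.dim (U.cmProd F (blkB Ξ))) := U.castC _ hK.symm (U.fmono xB K q)
  have htrω : U.trC _ (2 * U.dim (U.cmProd F (blkB Ξ))) ω ≠ 0 := U.trC_fmono_ne_zero xB M hN1 ht hxB hsp hqb.1 hK.symm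
  have hωw : U.IsWeightVector F (blkB Ξ) (fun _ => Finset.univ) (2 * U.dim (U.cmProd F (blkB Ξ))) ω := by
    have h := isWeightVector_fmono xB M hxB K q hqb.1
    rw [wtOf_eq_univ_of_surjective hqb.2] at h
    exact U.isWeightVector_castC F (blkB Ξ) _ hK.symm h
  -- `Z := p_Y^* x ∪ p_{Y'}^* ω ≠ 0`, of weight `((∅)_j, univ)`: character `0`, positive degree
  obtain ⟨gy, hgy1, hgy2⟩ := h7 F n 0 Ξ pA pB hP
  have calc2 := gyC_proj gy hgy2 (2 * 0) x₂ ω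
  have hZ0 : U.cupC (U.cmProd F Ξ) (2 * 0) (2 * U.dim (U.cmProd F (blkB Ξ))) (U.pullC pA (2 * 0) x₂)
      (U.pullC pB (2 * U.dim (U.cmProd F (blkB Ξ))) ω) ≠ 0 := by
    intro h
    rw [h, map_zero] at calc2
    rcases smul_eq_zero.mp calc2.symm with h' | h'
    · exact htrω h'
    · exact hx₂0 h'
  have hxw0 : U.IsWeightVector F Ξ (fun _ => ∅) (2 * 0) (U.pullC pA (2 * 0) x₂) := isWeightVector_zero hN3 _
  have hZw : U.IsWeightVector F Ξ
      (Fin.append (fun _ : Fin (n + 1) => (∅ : Finset ((F : Type) →+* ℂ))) (fun _ : Fin (0 + 1) => Finset.univ) :)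
      (2 * 0 + 2 * U.dim (U.cmProd F (blkB Ξ)))
      (U.cupC (U.cmProd F Ξ) (2 * 0) (2 * U.dim (U.cmProd F (blkB Ξ))) (U.pullC pA (2 * 0) x₂)
        (U.pullC pB (2 * U.dim (U.cmProd F (blkB Ξ))) ω)) := by
    have h := U.isWeightVector_cupC_of_disjoint M.pull_cup (S := fun _ => ∅)
      (S' := (Fin.append (fun _ : Fin (n + 1) => (∅ : Finset ((F : Type) →+* ℂ)))
        (fun _ : Fin (0 + 1) => Finset.univ) :))
      (fun _ => Finset.disjoint_empty_left _) hxw0 (U.isWeightVector_pullC_blkB Ξ M hN1 hP (by omega) hωw)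
    simpa only [Finset.empty_union] using h
  have hdeg0 : 2 * 0 + 2 * U.dim (U.cmProd F (blkB Ξ)) = 2 * U.dim (U.cmProd F (blkB Ξ)) := by omega
  let Z : U.WVec F := ⟨n + 1 + 0, Ξ, U.dim (U.cmProd F (blkB Ξ)),
    (Fin.append (fun _ : Fin (n + 1) => (∅ : Finset ((F : Type) →+* ℂ))) (fun _ : Fin (0 + 1) => Finset.univ) :),
    U.castC _ hdeg0 (U.cupC (U.cmProd F Ξ) (2 * 0) (2 * U.dim (U.cmProd F (blkB Ξ))) (U.pullC pA (2 * 0) x₂)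
      (U.pullC pB (2 * U.dim (U.cmProd F (blkB Ξ))) ω)),
    fun h => hZ0 ((LinearEquiv.map_eq_zero_iff _).mp h), U.isWeightVector_castC F Ξ _ hdeg0 hZw⟩
  have hZa : Z.achar = 0 := by
    show lefChar Ξ (Fin.append (fun _ : Fin (n + 1) => (∅ : Finset ((F : Type) →+* ℂ)))
      (fun _ : Fin (0 + 1) => Finset.univ) :) = 0
    rw [lefChar_append, lefChar_univ_eq_zero, add_zero]
    unfold lefChar
    simp
  have hZalg : Z.IsAlg := hpos F hG h6 Z hdpos hZa
  change U.castC _ hdeg0 (U.cupC (U.cmProd F Ξ) (2 * 0) (2 * U.dim (U.cmProd F (blkB Ξ))) (U.pullC pA (2 * 0) x₂)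
      (U.pullC pB (2 * U.dim (U.cmProd F (blkB Ξ))) ω)) ∈ U.algC (U.cmProd F Ξ) (U.dim (U.cmProd F (blkB Ξ))) at hZalg
  -- push forward: `p_{Y*} Z = (∫ ω) • x` is algebraic (F7), hence so is `x`
  refine hax.mpr ?_
  have hA2 := (U.castC_mem_algC_iff (U.cmProd F Ξ) (show U.dim (U.cmProd F (blkB Ξ)) = 0 + U.dim (U.cmProd F (blkB Ξ))
    by omega) (by omega) _).mpr hZalg
  have hA3 := gyC_mem_algC gy hgy1 0 hA2 (by omega)
  simp only [castC_castC, castC_self] at hA3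
  rw [calc2] at hA3
  exact ((U.algC _ 0).smul_mem_iff htrω).mp hA3

/-! ## 11. Assembly -/

/-- **`Qw8Sufficiency` from the positive-degree steps, Milne (iv), its degree-0 residue and the face bridge** —
the argument of `qw8Sufficiency_of_steps` run inside the characters of algebraic weight vectors of POSITIVE
degree (step (i) keeps the degree; the face vectors have degree 4); an `e` of degree 0 is `Qw8MilneZero`. -/
theorem qw8Sufficiency_of_steps_pos (hE : U.Qw8ExtProdPos) (hD : U.Qw8DualPushPullPos) (hM : U.Qw8Milne)
    (hM0 : U.Qw8MilneZero) (hB : U.Qw8FaceBridge) : U.Qw8Sufficiency := by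
  intro F hGal h6 hWeil n Θ p S x _hS hx hchar
  by_cases hx0 : x = 0
  · rw [hx0]; exact Submodule.zero_mem _
  obtain ⟨σ₀, m, f, c, hsum⟩ := hchar
  let e : U.WVec F := ⟨n, Θ, p, S, x, hx0, hx⟩
  change e.IsAlg
  rcases Nat.eq_zero_or_pos p with hp | hp
  · exact hM0 F hGal h6 e hp
  have he : e.achar = lefChar Θ S := rfl
  by_cases ha : e.achar = 0
  · exact hM F hGal h6 e ha
  -- the set of characters carried by nonzero algebraic weight vectors of positive degree
  let A : Set (Asym F) := {a | ∃ z : U.WVec F, z.IsAlg ∧ 0 < z.p ∧ z.achar = a}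
  have hAneg : ∀ a ∈ A, -a ∈ A := by
    rintro a ⟨z, hz, hzp, rfl⟩
    exact ⟨z.conj, hz.conj, hzp, z.achar_conj⟩
  have hAadd : ∀ a ∈ A, ∀ b ∈ A, a + b ∈ A := by
    rintro a ⟨z, hz, hzp, rfl⟩ b ⟨w, hw, hwp, rfl⟩
    obtain ⟨y, hy, hyp, h'⟩ := hE F hGal h6 z w hz hw hzp hwp
    exact ⟨y, hy, hyp, h'⟩
  have hface : ∀ i, lefChar (f i).corner (fun _ => ({σ₀} : Finset ((F : Type) →+* ℂ))) ∈ A := by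
    intro i
    obtain ⟨y, hy0, hyw, hya⟩ := hB F hGal h6 (f i) (hWeil (f i)) σ₀
    exact ⟨⟨3, (f i).corner, 2, fun _ => {σ₀}, y, hy0, hyw⟩, hya, two_pos, rfl⟩
  -- the combination is nonempty since `a(e) ≠ 0`
  have hm : 0 < m := by
    rcases Nat.eq_zero_or_pos m with rfl | hm
    · exact absurd (by rw [he, hsum]; simp) ha
    · exact hm
  have h0 : (0 : Asym F) ∈ A := by
    have h := hAadd _ (hface ⟨0, hm⟩) _ (hAneg _ (hface ⟨0, hm⟩))
    rwa [add_neg_cancel] at h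
  let G : AddSubgroup (Asym F) :=
    { carrier := A
      zero_mem' := h0
      add_mem' := fun ha hb => hAadd _ ha _ hb
      neg_mem' := fun ha => hAneg _ ha }
  have heA : e.achar ∈ G := by
    rw [he, hsum]
    exact G.sum_mem (fun i _ => G.zsmul_mem (hface i) (c i))
  obtain ⟨W, hW, hWp, hWa⟩ := heA
  obtain ⟨Z, hZa, hZ⟩ := hD F hGal h6 e W hp hWp hW
  exact hZ (hM F hGal h6 Z (by rw [hZa, hWa, sub_self]))

/-- **`Qw8Sufficiency` from the model axioms, N1–N4, F4, F5, F7 and the two generic facts `Fact_dimProd`,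
`Fact_trTopCM`** (the latter implied by the verbatim `Fact_trTop`) — no F2, no F6, no N5, no `Qw8MilneZero` hypothesis. -/
theorem qw8Sufficiency_of_genericFacts (M : U.ModelAxioms) (hN1 : U.Fact_cupExterior) (hN2 : U.Fact_cup_hodge)
    (hN3 : U.Fact_pull_H0) (hN4 : U.Fact_hodge_F0) (h4 : U.Fact_cupAlg) (h5 : U.Fact_cupAssoc)
    (h7 : U.Fact_gysin) (hd : U.Fact_dimProd) (ht : U.Fact_trTopCM) : U.Qw8Sufficiency :=
  have hpos := qw8MilnePos_of_facts M hN1 hN2 hN3 hN4 h4 h5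
  have h0 := U.qw8MilneZero_of_genericFacts M hN1 hN3 h7 hd ht hpos
  U.qw8Sufficiency_of_steps_pos (U.qw8ExtProdPos_of_facts M hN1 h4 h5 h7 hd ht)
    (U.qw8DualPushPullPos_of_facts M hN1 h4 h5 h7 hd ht) (qw8Milne_of_pos_of_zero hpos h0) h0
    (qw8FaceBridge_holds M)

/-- `Qw8Milne` (all degrees) from the model axioms, N1–N4, F4, F5, F7 and the two generic facts. -/
theorem qw8Milne_of_genericFacts (M : U.ModelAxioms) (hN1 : U.Fact_cupExterior) (hN2 : U.Fact_cup_hodge)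
    (hN3 : U.Fact_pull_H0) (hN4 : U.Fact_hodge_F0) (h4 : U.Fact_cupAlg) (h5 : U.Fact_cupAssoc)
    (h7 : U.Fact_gysin) (hd : U.Fact_dimProd) (ht : U.Fact_trTopCM) : U.Qw8Milne :=
  have hpos := qw8MilnePos_of_facts M hN1 hN2 hN3 hN4 h4 h5
  qw8Milne_of_pos_of_zero hpos (U.qw8MilneZero_of_genericFacts M hN1 hN3 h7 hd ht hpos)

end Universe

namespace Assembly

/-- **COR-CM from the model axioms, the standard facts N1–N4, F4, F5, F7, the two generic facts
`Fact_dimProd` (dimension of a product) and `Fact_trTopCM` (`∫` is injective on `H^{2 dim A′}(A′, ℚ)` for the CM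
products `A′`), and the face realisation.**  Compared with `COR_CM_of_geometricFacts_zero` the hypotheses
F2 `Fact_factorActDescends`, F6 `Fact_weightDual` and `Qw8MilneZero` are GONE (theorems of the monomial calculus in
this file).  The verbatim textbook form `Fact_trTop` discharges `ht`: `COR_CM_of_genericFacts'`. -/
theorem COR_CM_of_genericFacts (U : Universe) (M : U.ModelAxioms) (hR : U.RealisationExistsFace)
    (hN1 : U.Fact_cupExterior) (hN2 : U.Fact_cup_hodge) (hN3 : U.Fact_pull_H0) (hN4 : U.Fact_hodge_F0)
    (h4 : U.Fact_cupAlg) (h5 : U.Fact_cupAssoc) (h7 : U.Fact_gysin) (hd : U.Fact_dimProd) (ht : U.Fact_trTopCM) :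
    U.HC_CM :=
  COR_CM U M hR (U.pohlmannSpan_of_facts M hN1 hN2 hN3 hN4)
    (U.qw8Sufficiency_of_genericFacts M hN1 hN2 hN3 hN4 h4 h5 h7 hd ht)

/-- The same with the verbatim textbook fact `Fact_trTop` (`∫_X : H^{2 dim X}(X, ℚ) → ℚ` bijective for every
connected smooth projective `X`) in place of its CM-product restriction. -/
theorem COR_CM_of_genericFacts' (U : Universe) (M : U.ModelAxioms) (hR : U.RealisationExistsFace)
    (hN1 : U.Fact_cupExterior) (hN2 : U.Fact_cup_hodge) (hN3 : U.Fact_pull_H0) (hN4 : U.Fact_hodge_F0)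
    (h4 : U.Fact_cupAlg) (h5 : U.Fact_cupAssoc) (h7 : U.Fact_gysin) (hd : U.Fact_dimProd) (ht : U.Fact_trTop) :
    U.HC_CM :=
  COR_CM_of_genericFacts U M hR hN1 hN2 hN3 hN4 h4 h5 h7 hd (U.trTopCM_of_trTop ht)

end Assembly

end HodgeCM

end
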